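import Literature.MathematicalPhysics.QuantumFieldTheory.Balaban1983to89.Beta.GaugeFixing

/-!
# `BalabanUV.Beta.D1BFx.ProjectorWeightUnfold` — road «BF-x» for binder row D1, slot (K), row **(K8-L)(d) CENSUS, group G_R** (owner ruling ρ-g8-4): THE
# GAUSSIAN UN-PROJECTION OF A PROJECTOR WEIGHT AT THE DETERMINANT LEVEL — the bordered determinant with the weight `c·D·R·Dᵀ`, `R = 1 − M(MᵀM)⁻¹Mᵀ`
# the orthogonal projector onto `(range M)^⊥`, IS the bordered determinant of the `M`-AUGMENTED system with the PROJECTOR-FREE weight `c·‖Dᵀa − Mη‖²`, divided by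
# the coarse Gram `det(c·MᵀM)`: `det [[kkt (K + c·DDᵀ) Q, [−c·DM; 0]], [[−c·MᵀDᵀ, 0], c·MᵀM]] = det(c·MᵀM) · det kkt (K + c·D·R·Dᵀ) Q`

HONEST DEPENDENCY (cell records, verbatim): «continuum YM on T⁴ ⇐ BetaPertH ∧ nine spine estimates (0/9 proved); BetaPertH ⇐ (D1) ∧ (D4) ∧
CAP+tail; G-an2-4 gates asym, D1 and NE2/3/4.»  HONEST FRAMING (cell contract, verbatim): «discharging `BetaPertH` makes Bałaban's UV stability
UNCONDITIONAL — a real constructive-QFT result; it is NOT the continuum limit and NOT the Clay problem.»  THIS MODULE DISCHARGES NOTHING of (K),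
of D1 or of the wall: [folklore] finite-dimensional linear algebra (Mathlib's Schur-complement determinant `Matrix.det_fromBlocks₂₂`) over the tree's
`Beta.Composition.kkt`.  No definition, no `def … : Prop`, nothing cited, no wall binder instantiated, 0 sorry.  NOT D1, NOT BetaPertH, NOT continuum, NOT Clay.

ABSOLUTE RULE (cell charter, verbatim): «No internally-minted statement may enter as a cited fact. Every hypothesis is either kernel-proved in this
package or a verbatim quotation of a PUBLISHED theorem with page reference. The manuscript(s) under audit are NOT citable for their own disputed
steps — they are the thing under adjudication; programme-internal (2001/route/tribunal) claims are never citable.»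

WHY (owner ruling ρ-g8-4 on an3-g50's LETTER «MARGINAL-CLASSES» §3.3–3.4 and the owner's RESULT A1′, journal 2026-08-21).  Under (R1-L) the N-side of road
BF-x carries Bałaban's R-weight `c·D_U·R_U·D_U*` with `R_U = 1 − P_U` and `P_U` the orthogonal projector onto `range(G′_UQ′ᵀ)` ([B9, (3.25)], typed
`RProjector.Pgt`).  The JETS of the projector (`Ṙ = −Ṗ`: the smeared R-sector — `−dJetSw(Pgt)`, the K-corner dipole, the needle rows) are individually
power-large (A1′: the K-corner column is an extended lattice dipole of range ≈ n∕2) and cancel only as a GROUP.  This file gives the exact identity that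
removes the projector from the weight altogether: with `M := G′_UQ′ᵀ` and an auxiliary Gaussian variable `η` on the blocks, the projector weight is the
`η`-marginal of the PROJECTOR-FREE quadratic weight `c·‖D_U*a − Mη‖²`, at the price of the coarse Gram determinant `det(c·MᵀM) = det(c·Q′G′_U²Q′ᵀ)` — so the
G_R census is the census of `D_U`-jets, `G′_U`-insertion words and one coarse Gram tower, with no projector jets.  (`‖R v‖² = min_η ‖v − Mη‖²` and
`∫dη e^{−½c‖v−Mη‖²} = (2π)^{m∕2} det(cMᵀM)^{−½} e^{−½c‖Rv‖²}`; the determinant form below is its exact finite-dimensional content.)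
CONTENT (field `𝕜`; `ν` fields, `μ` constraints, `σ` gauge parameters, `m` blocks; `K : ν×ν`, `Q : μ×ν`, `D : ν×σ`, `M : σ×m`, `c : 𝕜`):
* §1 [folklore] `proj_compl` algebra: `D·(1 − M(MᵀM)⁻¹Mᵀ)·Dᵀ = DDᵀ − DM(MᵀM)⁻¹MᵀDᵀ` (`weight_unfold`).
* §2 [folklore] **`det_aug_eq_det_gram_mul_det_kkt`**: `c ≠ 0`, `det(MᵀM)` a unit ⟹
  `det (fromBlocks (kkt (K + c•DDᵀ) Q) [−c•DM; 0] [−c•MᵀDᵀ | 0] (c•MᵀM)) = det(c•MᵀM) · det kkt (K + c•(D(1 − M(MᵀM)⁻¹Mᵀ)Dᵀ)) Q`.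
* §3 [folklore] over `ℝ`: `log|det aug| = log|det(c•MᵀM)| + log|det kkt (K + c•DRDᵀ) Q|` (non-degenerate case).
Unit `b2b-balaban-beta-d1-p2` (road owner, gen 8); `CENSUS-K6a-v1.md` v2 group G_R; `K-END-RECUT-SPEC.md` §7.
-/

namespace Summit.QuantumFields.BalabanUV.Beta.D1BFx.ProjectorWeightUnfold

open Matrix
open Literature.MathematicalPhysics.QuantumFieldTheory.Balaban1983to89.Beta.Composition (kkt)

section Field

variable {𝕜 : Type*} [Field 𝕜]
variable {ν μ σ m : Type*} [Fintype ν] [Fintype μ] [Fintype σ] [Fintype m] [DecidableEq ν] [DecidableEq μ] [DecidableEq σ] [DecidableEq m]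

/-! ## §1 The projector-complement weight, expanded -/

omit [Fintype ν] [Fintype μ] [DecidableEq ν] [DecidableEq μ] in
/-- [folklore] `D·(1 − M(MᵀM)⁻¹Mᵀ)·Dᵀ = DDᵀ − D·M·(MᵀM)⁻¹·Mᵀ·Dᵀ`. -/
theorem weight_unfold (D : Matrix ν σ 𝕜) (M : Matrix σ m 𝕜) :
    D * (1 - M * (Mᵀ * M)⁻¹ * Mᵀ) * Dᵀ = D * Dᵀ - D * M * (Mᵀ * M)⁻¹ * Mᵀ * Dᵀ := by
  rw [Matrix.mul_sub, Matrix.mul_one, Matrix.sub_mul]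
  simp only [Matrix.mul_assoc]

/-! ## §2 The un-projection identity at the determinant level -/

/-- [folklore] **GAUSSIAN UN-PROJECTION OF A PROJECTOR WEIGHT (determinant form)**: for `c ≠ 0` and `det(MᵀM)` a unit,
`det (fromBlocks (kkt (K + c•DDᵀ) Q) (fromRows (−c•DM) 0) (fromCols (−c•MᵀDᵀ) 0) (c•MᵀM)) = det(c•MᵀM) · det kkt (K + c•D(1 − M(MᵀM)⁻¹Mᵀ)Dᵀ) Q`
— the Schur complement of the auxiliary block `c•MᵀM` is the bordered matrix of `K` plus the PROJECTOR weight `c·D·R·Dᵀ`, `R = 1 − M(MᵀM)⁻¹Mᵀ`. -/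
theorem det_aug_eq_det_gram_mul_det_kkt (K : Matrix ν ν 𝕜) (Q : Matrix μ ν 𝕜) (D : Matrix ν σ 𝕜) (M : Matrix σ m 𝕜) {c : 𝕜}
    (hc : c ≠ 0) (hM : IsUnit (Mᵀ * M).det) :
    (fromBlocks (kkt (K + c • (D * Dᵀ)) Q) (fromRows (-(c • (D * M))) (0 : Matrix μ m 𝕜))
        (fromCols (-(c • (Mᵀ * Dᵀ))) (0 : Matrix m μ 𝕜)) (c • (Mᵀ * M))).det
      = (c • (Mᵀ * M)).det * (kkt (K + c • (D * (1 - M * (Mᵀ * M)⁻¹ * Mᵀ) * Dᵀ)) Q).det := by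
  have hcu : IsUnit c := isUnit_iff_ne_zero.mpr hc
  have hG : IsUnit (c • (Mᵀ * M)).det := by
    rw [det_smul]
    exact (hcu.pow _).mul hM
  letI : Invertible (c • (Mᵀ * M)) := invertibleOfIsUnitDet _ hG
  rw [det_fromBlocks₂₂, invOf_eq_nonsing_inv]
  congr 1
  -- the Schur complement is the bordered matrix of the projector weight
  have hinv : (c • (Mᵀ * M))⁻¹ = c⁻¹ • (Mᵀ * M)⁻¹ := by
    apply Matrix.inv_eq_left_inv
    rw [Matrix.smul_mul, Matrix.mul_smul, smul_smul, nonsing_inv_mul _ hM, inv_mul_cancel₀ hc, one_smul]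
  have e : fromRows (-(c • (D * M))) (0 : Matrix μ m 𝕜) * (c • (Mᵀ * M))⁻¹ * fromCols (-(c • (Mᵀ * Dᵀ))) (0 : Matrix m μ 𝕜)
      = fromBlocks (c • (D * M * (Mᵀ * M)⁻¹ * Mᵀ * Dᵀ)) 0 0 (0 : Matrix μ μ 𝕜) := by
    rw [fromRows_mul, fromRows_mul_fromCols, hinv]
    simp only [Matrix.zero_mul, Matrix.mul_zero, Matrix.neg_mul, Matrix.mul_neg, Matrix.smul_mul,
      Matrix.mul_smul, smul_smul]
    rw [mul_inv_cancel₀ hc]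
    simp only [one_smul, neg_neg, smul_zero, neg_zero, Matrix.mul_assoc]
  rw [e]
  unfold kkt
  rw [sub_eq_add_neg, fromBlocks_neg, fromBlocks_add]
  congr 1
  rw [weight_unfold, smul_sub]
  simp only [Matrix.mul_assoc]
  abel

end Field

/-! ## §3 Over `ℝ`: the logarithmic form -/

section Real

variable {ν μ σ m : Type*} [Fintype ν] [Fintype μ] [Fintype σ] [Fintype m] [DecidableEq ν] [DecidableEq μ] [DecidableEq σ] [DecidableEq m]

/-- [folklore] **LOG FORM**: `log|det aug| = log|det(c•MᵀM)| + log|det kkt (K + c•DRDᵀ) Q|` when both factors are non-degenerate — the one-loop functional of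
the R-weighted system is that of the projector-free `M`-augmented system MINUS the coarse Gram tower `log|det(c•MᵀM)|`. -/
theorem log_absDet_aug (K : Matrix ν ν ℝ) (Q : Matrix μ ν ℝ) (D : Matrix ν σ ℝ) (M : Matrix σ m ℝ) {c : ℝ} (hc : c ≠ 0)
    (hM : (Mᵀ * M).det ≠ 0) (hN : (kkt (K + c • (D * (1 - M * (Mᵀ * M)⁻¹ * Mᵀ) * Dᵀ)) Q).det ≠ 0) :
    Real.log |(fromBlocks (kkt (K + c • (D * Dᵀ)) Q) (fromRows (-(c • (D * M))) (0 : Matrix μ m ℝ))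
        (fromCols (-(c • (Mᵀ * Dᵀ))) (0 : Matrix m μ ℝ)) (c • (Mᵀ * M))).det|
      = Real.log |(c • (Mᵀ * M)).det| + Real.log |(kkt (K + c • (D * (1 - M * (Mᵀ * M)⁻¹ * Mᵀ) * Dᵀ)) Q).det| := by
  rw [det_aug_eq_det_gram_mul_det_kkt K Q D M hc (isUnit_iff_ne_zero.mpr hM), abs_mul]
  have h1 : |(c • (Mᵀ * M)).det| ≠ 0 := by
    rw [det_smul]; exact abs_ne_zero.mpr (mul_ne_zero (pow_ne_zero _ hc) hM)
  rw [Real.log_mul h1 (abs_ne_zero.mpr hN)]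

end Real

end Summit.QuantumFields.BalabanUV.Beta.D1BFx.ProjectorWeightUnfold
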